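import Summits.QuantumFields.YangMills.Theorems.ColdStartUniversalityLatticeLangevinLawUniqueStart
import Summits.QuantumFields.YangMills.Theorems.ColdStartUniversalityLatticeLangevinMeasurableFlow
import Summits.QuantumFields.YangMills.Theorems.ColdStartUniversalityLatticeLangevinGaugeCovarianceAlgebra
import Literature.Probability.Process.ItoIntegralNegation
import HarnessLib

/-!
# Route `ColdStartUniversality` (LINE 6 «centre-sector reduction», crux K_A1|Γ `NeutralColdStartMixing`
# stmt-QuantumFields-27363): THE SZZ LATTICE LANGEVIN DYNAMICS COMMUTES WITH THE ELECTRIC CENTRE TWISTS — pathwise half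

Helper file (seat `ym-line-csu-p1`, g14; `--supports stmt-QuantumFields-27363`).  The rev-3 line card of the route
(«centre superselection splits the leaf») uses, besides the STATIC centre symmetry of every Wilson theory on the torus
(tree: `CentreTwist`, `T3CentreSymmetry.expectAt_eq_zero_of_odd_SU2`), the DYNAMIC statement «the SZZ dynamics commutes
with the `Z₂³` centre twists (central `z`: drift and left-invariant noise are equivariant), so on centre-invariant
observables it is the lumped quotient process».  This file kernel-checks the pathwise half of that statement for the
`SU(2)` Shen–Zhu–Zhu system `latticeLangevinDynamics (fundamentalLatticeRep 2) β'` on `(ℤ/L)³`, in the following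
generality: a FLAT CENTRE FIELD is a configuration `c : Edge → SU(2)` with values in the centre `{±1}` and trivial
plaquette holonomies (every 't Hooft twist `U(x, μ) ↦ −U(x, μ)` for `x_μ = s`, in any direction `μ`, is one; so is every
`Z₂`-valued lattice gauge transformation); it acts on configurations by pointwise multiplication `U ↦ c * U`.

* §1 (algebra, any lattice representation datum `r`, any `d`): for a flat SIGN field `σ : Edge → {±1} ⊂ ℂ` the rooted
  plaquette loops of `Q' = σ • Q` are those of `Q` (`rootedLoop_signMul`), so the Lie drift is invariant
  (`driftLie_signMul`) and the SZZ drift and noise coefficients pick up the sign of the link: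
  `b_e(σ•Q) = σ_e b_e(Q)` (`drift_signMul`), `σ_{e,n}(σ•Q) = σ_e σ_{e,n}(Q)` (`noise_signMul`).
* §2 (`SU(2)`): the sign field of a flat centre field (`exists_sign`, `sign_flat`), `ρ(c * U) = σ • ρ(U)`
  (`matrixConfig_centreMul`), continuity / measurability of `U ↦ c * U`.
* §3 ★ `isSolution_centreMul` — if `U` solves the SZZ system driven by `W` w.r.t. ANY filtration `𝓕`, then so does
  `t ↦ c * U_t`, with the SAME driver and filtration (Itô integrals `σ_e J^{e,n}`; `IsItoIntegral.neg`).

The law-level consequences (`law(c·u ⇝ t) = (c·)_* law(u ⇝ t)`, `P_t f (c·x) = P_t (f ∘ c·) x`, lumping of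
centre-invariant observables, sign rule for centre-odd ones) are in `…LatticeLangevinCentreCovarianceLaw`.
THEOREMS ONLY, [folklore] (equivariance of a left-invariant SDE under central translations; 't Hooft 1979 §2 for the
twists; SZZ arXiv:2204.12737 §3 Lemma 3.1 for the form of the system).  RECORD-rung R3 plumbing: no crux, rung or summit
statement is proved here and the Yang–Mills mass gap is NOT proved.
-/

set_option autoImplicit false

noncomputable section

namespace Summit.QuantumFields.YangMills.Theorems.ColdStartUniversality.CentreCovariance

open MeasureTheory ProbabilityTheory Filter Matrix
open scoped NNReal ENNReal BigOperators
open Literature.Probability.Process Literature.MathematicalPhysics.QuantumFieldTheory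
open Literature.MathematicalPhysics.QuantumLattice (fundamentalRep fundamentalLatticeRep)

/-! ## §1 Algebra: flat sign fields -/

section Algebra

variable {G : Type*} [Group G] [TopologicalSpace G] (r : LatticeRep G) {d L N : ℕ}

/-- Scalars pull out of a loop product of type `A B Cᴴ Dᴴ`. [folklore] -/
theorem smul_loop_false (a b c d' : ℂ) (A B C D : Matrix (Fin N) (Fin N) ℂ) :
    (a • A) * (b • B) * (c • C)ᴴ * (d' • D)ᴴ = (a * b * star c * star d') • (A * B * Cᴴ * Dᴴ) := by
  simp only [Matrix.conjTranspose_smul, Matrix.smul_mul, Matrix.mul_smul, smul_smul]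
  congr 1
  ring

/-- Scalars pull out of a loop product of type `A Bᴴ Cᴴ D`. [folklore] -/
theorem smul_loop_true (a b c d' : ℂ) (A B C D : Matrix (Fin N) (Fin N) ℂ) :
    (a • A) * (b • B)ᴴ * (c • C)ᴴ * (d' • D) = (a * star b * star c * d') • (A * Bᴴ * Cᴴ * D) := by
  simp only [Matrix.conjTranspose_smul, Matrix.smul_mul, Matrix.mul_smul, smul_smul]
  congr 1
  ring

variable (σ : Edge d L → ℂ) (hσ : ∀ e, σ e = 1 ∨ σ e = -1)
  (hflat : ∀ (x : Literature.MathematicalPhysics.QuantumFieldTheory.Site d L) (i j : Fin d), i ≠ j →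
    σ (x, i) * σ (x.shift i, j) * σ (x.shift j, i) * σ (x, j) = 1)

include hσ in
/-- A sign is real: `star σ_e = σ_e`. [folklore] -/
theorem star_sign (e : Edge d L) : star (σ e) = σ e := by
  rcases hσ e with h | h <;> simp [h]

include hσ hflat in
/-- ★ **A flat sign field leaves every rooted plaquette loop invariant**: the loop through `e` in the plane `{e.2, j}`
(`j ≠ e.2`) of `σ • Q` is that of `Q` — each plaquette carries an even number of flipped links. [cite: tHooft1979Flux, §2] -/
theorem rootedLoop_signMul (Q : MatrixConfig d L N) (e : Edge d L) {j : Fin d} (hj : j ≠ e.2) (b : Bool) :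
    rootedLoop (fun e' : Edge d L => σ e' • Q e') e j b = rootedLoop Q e j b := by
  obtain ⟨x, i⟩ := e
  have hij : i ≠ j := fun h => hj h.symm
  cases b with
  | false =>
    simp only [rootedLoop]
    rw [smul_loop_false, star_sign σ hσ, star_sign σ hσ, hflat x i j hij, one_smul]
  | true =>
    simp only [rootedLoop]
    rw [smul_loop_true, star_sign σ hσ, star_sign σ hσ]
    have key : σ (x, i) * σ ((x - Pi.single j (1 : ZMod L)).shift i, j) * σ (x - Pi.single j (1 : ZMod L), i) *
        σ (x - Pi.single j (1 : ZMod L), j) =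
        σ (x - Pi.single j (1 : ZMod L), i) * σ ((x - Pi.single j (1 : ZMod L)).shift i, j) *
          σ ((x - Pi.single j (1 : ZMod L)).shift j, i) * σ (x - Pi.single j (1 : ZMod L), j) := by
      rw [GaugeCovariance.sub_single_shift]
      ring
    rw [key, hflat _ i j hij, one_smul]

include hσ hflat in
/-- **The Lie drift is invariant under a flat sign field**: `driftLie(σ•Q)_e = driftLie(Q)_e`. [cite: ShenZhuZhu2022, §3 Lemma 3.1] -/
theorem driftLie_signMul (β : ℝ) (Q : MatrixConfig d L r.N) (e : Edge d L) :
    r.driftLie β (fun e' : Edge d L => σ e' • Q e') e = r.driftLie β Q e := by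
  unfold LatticeRep.driftLie
  refine congrArg (fun M : Matrix (Fin r.N) (Fin r.N) ℂ => β • M) ?_
  refine Finset.sum_congr rfl fun j hj => Finset.sum_congr rfl fun b _ => ?_
  rw [rootedLoop_signMul σ hσ hflat Q e (Finset.ne_of_mem_erase hj) b]

include hσ hflat in
/-- ★ **The SZZ drift picks up the sign of the link**: `b_e(σ•Q) = σ_e • b_e(Q)`. [cite: ShenZhuZhu2022, §3 Lemma 3.1] -/
theorem drift_signMul (β : ℝ) (Q : MatrixConfig d L r.N) (e : Edge d L) :
    (latticeLangevinDynamics r β).drift (fun e' : Edge d L => σ e' • Q e') e =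
      σ e • (latticeLangevinDynamics r β).drift Q e := by
  simp only [latticeLangevinDynamics_drift]
  rw [driftLie_signMul r σ hσ hflat, Matrix.mul_smul]

/-- ★ **The SZZ noise coefficients pick up the sign of the link**: `σ_{e,n}(σ•Q) = σ_e • σ_{e,n}(Q)` (no flatness
needed). [cite: ShenZhuZhu2022, §3 (the SDE system after Lemma 3.1)] -/
theorem noise_signMul (β : ℝ) (Q : MatrixConfig d L r.N) (e : Edge d L) (n : NoiseIdx r.N) :
    (latticeLangevinDynamics r β).noise (fun e' : Edge d L => σ e' • Q e') e n =
      σ e • (latticeLangevinDynamics r β).noise Q e n := by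
  simp only [latticeLangevinDynamics_noise, Matrix.mul_smul]
  rw [smul_comm]

end Algebra

/-! ## §2 Flat centre fields on `SU(2)` configurations -/

section SU2

variable {d L : ℕ}

/-- ★ **`ρ(c * U) = σ • ρ(U)`**: a field `c` with `ρ(c_e) = σ_e • 1` acts on matrix coordinates by its signs (any group,
any matrix representation). [folklore] -/
theorem matrixConfig_centreMul {G : Type*} [Group G] {N : ℕ} (ρ : G →* Matrix (Fin N) (Fin N) ℂ)
    (c U : GaugeConfig d L G) (σ : Edge d L → ℂ) (hcρ : ∀ e, ρ (c e) = σ e • (1 : Matrix (Fin N) (Fin N) ℂ)) :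
    matrixConfig ρ (c * U) = fun e : Edge d L => σ e • matrixConfig ρ U e := by
  funext e
  simp only [matrixConfig, Pi.mul_apply, map_mul, hcρ, Matrix.smul_mul, Matrix.one_mul]

/-- **The sign field of a centre-valued configuration**: if every `c_e ∈ {±1} = Z(SU(2))` then `ρ(c_e) = σ_e • 1` with
`σ_e ∈ {±1} ⊂ ℂ`. [folklore] -/
theorem exists_sign (c : GaugeConfig d L (Matrix.specialUnitaryGroup (Fin 2) ℂ))
    (hc : ∀ e, ((c e : Matrix.specialUnitaryGroup (Fin 2) ℂ) : Matrix (Fin 2) (Fin 2) ℂ) = 1 ∨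
      ((c e : Matrix.specialUnitaryGroup (Fin 2) ℂ) : Matrix (Fin 2) (Fin 2) ℂ) = -1) :
    ∃ σ : Edge d L → ℂ, (∀ e, σ e = 1 ∨ σ e = -1) ∧
      ∀ e, ((c e : Matrix.specialUnitaryGroup (Fin 2) ℂ) : Matrix (Fin 2) (Fin 2) ℂ) =
        σ e • (1 : Matrix (Fin 2) (Fin 2) ℂ) := by
  classical
  refine ⟨fun e => if ((c e : Matrix.specialUnitaryGroup (Fin 2) ℂ) : Matrix (Fin 2) (Fin 2) ℂ) = 1 then 1 else -1,
    fun e => ?_, fun e => ?_⟩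
  · by_cases h : ((c e : Matrix.specialUnitaryGroup (Fin 2) ℂ) : Matrix (Fin 2) (Fin 2) ℂ) = 1
    · exact Or.inl (if_pos h)
    · exact Or.inr (if_neg h)
  · show ((c e : Matrix.specialUnitaryGroup (Fin 2) ℂ) : Matrix (Fin 2) (Fin 2) ℂ) =
      (if ((c e : Matrix.specialUnitaryGroup (Fin 2) ℂ) : Matrix (Fin 2) (Fin 2) ℂ) = 1 then (1 : ℂ) else -1) •
        (1 : Matrix (Fin 2) (Fin 2) ℂ)
    rcases hc e with h | h
    · rw [if_pos h, h, one_smul]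
    · have hne : ((c e : Matrix.specialUnitaryGroup (Fin 2) ℂ) : Matrix (Fin 2) (Fin 2) ℂ) ≠ 1 := by
        rw [h]
        intro h1
        have h00 := congrArg (fun M : Matrix (Fin 2) (Fin 2) ℂ => M 0 0) h1
        simp only [Matrix.neg_apply, Matrix.one_apply_eq] at h00
        norm_num at h00
      rw [if_neg hne, h, neg_one_smul]

/-- **Flatness passes to the sign field**: trivial plaquette holonomies of the centre field `c` give
`σ(x,i) σ(x+eᵢ,j) σ(x+eⱼ,i) σ(x,j) = 1`. [cite: tHooft1979Flux, §2] -/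
theorem sign_flat (c : GaugeConfig d L (Matrix.specialUnitaryGroup (Fin 2) ℂ)) (σ : Edge d L → ℂ)
    (hσ : ∀ e, σ e = 1 ∨ σ e = -1)
    (hcσ : ∀ e, ((c e : Matrix.specialUnitaryGroup (Fin 2) ℂ) : Matrix (Fin 2) (Fin 2) ℂ) =
      σ e • (1 : Matrix (Fin 2) (Fin 2) ℂ))
    (hflat : ∀ (x : Literature.MathematicalPhysics.QuantumFieldTheory.Site d L) (i j : Fin d), i ≠ j →
      plaquetteHolonomy c x i j = 1)
    (x : Literature.MathematicalPhysics.QuantumFieldTheory.Site d L) (i j : Fin d) (hij : i ≠ j) :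
    σ (x, i) * σ (x.shift i, j) * σ (x.shift j, i) * σ (x, j) = 1 := by
  -- the inverse in `SU(2)` is the adjoint (tree: `CrossoverCertificate.Negative.su2_coe_inv`, by `rfl`)
  have hinv : ∀ g : Matrix.specialUnitaryGroup (Fin 2) ℂ,
      ((g⁻¹ : Matrix.specialUnitaryGroup (Fin 2) ℂ) : Matrix (Fin 2) (Fin 2) ℂ) = star (g : Matrix (Fin 2) (Fin 2) ℂ) :=
    fun _ => rfl
  have h := congrArg (fun g : Matrix.specialUnitaryGroup (Fin 2) ℂ => (g : Matrix (Fin 2) (Fin 2) ℂ) 0 0)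
    (hflat x i j hij)
  simp only [plaquetteHolonomy, Submonoid.coe_mul, hinv, hcσ, Matrix.star_eq_conjTranspose,
    Matrix.conjTranspose_smul, Matrix.conjTranspose_one, star_sign σ hσ, Matrix.mul_smul, smul_smul,
    Matrix.smul_apply, Matrix.one_apply_eq, smul_eq_mul, mul_one, OneMemClass.coe_one] at h
  linear_combination h

/-- `U ↦ c * U` is continuous on `SU(2)` configurations. [folklore] -/
theorem continuous_centreMul (c : GaugeConfig d L (Matrix.specialUnitaryGroup (Fin 2) ℂ)) :
    Continuous fun U : GaugeConfig d L (Matrix.specialUnitaryGroup (Fin 2) ℂ) => c * U :=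
  continuous_const.mul continuous_id

/-- `c * U_t` is measurable for any σ-algebra on `Ω` for which `U_t` is (adaptedness transfers; `d = 3`, where the tree's
Borel structure on `SU(2)` configurations lives). [folklore] -/
theorem measurable_centreMul_comp {L : ℕ} [NeZero L] {Ω : Type*} {mΩ' : MeasurableSpace Ω}
    (c : GaugeConfig 3 L (Matrix.specialUnitaryGroup (Fin 2) ℂ))
    {X : Ω → GaugeConfig 3 L (Matrix.specialUnitaryGroup (Fin 2) ℂ)} (hX : Measurable[mΩ'] X) :
    Measurable[mΩ'] fun ω => c * X ω := by
  haveI := secondCountableTopology_su2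
  haveI := borelSpace_config L
  exact (continuous_centreMul c).measurable.comp hX

/-- `U ↦ c * U` is a measurable self-map of the configuration space (`d = 3`). [folklore] -/
theorem measurable_centreMul {L : ℕ} [NeZero L] (c : GaugeConfig 3 L (Matrix.specialUnitaryGroup (Fin 2) ℂ)) :
    Measurable fun U : GaugeConfig 3 L (Matrix.specialUnitaryGroup (Fin 2) ℂ) => c * U :=
  measurable_centreMul_comp c measurable_id

end SU2

/-! ## §3 The pathwise transfer -/

section Transfer

/-- `∫ (−H) dB = −∫ H dB` for complex integrands. [folklore] -/
theorem isItoIntegralC_neg {Ω : Type*} {m : MeasurableSpace Ω} {H J : ℝ≥0 → Ω → ℂ} {B : ℝ≥0 → Ω → ℝ}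
    {𝓕 : Filtration ℝ≥0 m} {P : Measure Ω} (h : IsItoIntegralC H B J 𝓕 P) :
    IsItoIntegralC (fun t ω => -H t ω) B (fun t ω => -J t ω) 𝓕 P :=
  ⟨by simpa only [Complex.neg_re] using h.1.neg, by simpa only [Complex.neg_im] using h.2.neg⟩

/-- `∫ (sH) dB = s ∫ H dB` for a sign `s = ±1` and complex integrands. [folklore] -/
theorem isItoIntegralC_signMul {Ω : Type*} {m : MeasurableSpace Ω} {H J : ℝ≥0 → Ω → ℂ} {B : ℝ≥0 → Ω → ℝ}
    {𝓕 : Filtration ℝ≥0 m} {P : Measure Ω} (h : IsItoIntegralC H B J 𝓕 P) {s : ℂ} (hs : s = 1 ∨ s = -1) :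
    IsItoIntegralC (fun t ω => s * H t ω) B (fun t ω => s * J t ω) 𝓕 P := by
  rcases hs with rfl | rfl
  · simpa only [one_mul] using h
  · simpa only [neg_one_mul] using isItoIntegralC_neg h

variable {L : ℕ} [NeZero L] {Ω : Type*} {mΩ : MeasurableSpace Ω} {P : Measure Ω} {𝓕 : Filtration ℝ≥0 mΩ}
  {W : ℝ≥0 → Ω → (Edge 3 L × NoiseIdx 2 → ℝ)}

/-- ★★ **The SZZ dynamics commutes with flat centre fields (pathwise).**  Let `c : Edge → SU(2)` take values in the centre
`{±1}` and have trivial plaquette holonomies (a product of 't Hooft twists and a `Z₂` gauge transformation).  If `U` solves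
the `SU(2)` lattice Langevin system at coupling `β'` driven by `W` w.r.t. a filtration `𝓕`, then `t ↦ c * U_t` solves the
SAME system, driven by the SAME `W`, w.r.t. the same `𝓕` (its Itô integrals are `σ_e J^{e,n}`). [cite: tHooft1979Flux, §2] -/
theorem isSolution_centreMul (β' : ℝ) (c : GaugeConfig 3 L (Matrix.specialUnitaryGroup (Fin 2) ℂ))
    (hc : ∀ e, ((c e : Matrix.specialUnitaryGroup (Fin 2) ℂ) : Matrix (Fin 2) (Fin 2) ℂ) = 1 ∨
      ((c e : Matrix.specialUnitaryGroup (Fin 2) ℂ) : Matrix (Fin 2) (Fin 2) ℂ) = -1)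
    (hflat : ∀ (x : Literature.MathematicalPhysics.QuantumFieldTheory.Site 3 L) (i j : Fin 3), i ≠ j →
      plaquetteHolonomy c x i j = 1)
    {U : ℝ≥0 → Ω → GaugeConfig 3 L (Matrix.specialUnitaryGroup (Fin 2) ℂ)}
    (hU : (latticeLangevinDynamics (fundamentalLatticeRep 2) β').IsSolution (fundamentalRep (Fin 2)) 𝓕 P W U) :
    (latticeLangevinDynamics (fundamentalLatticeRep 2) β').IsSolution (fundamentalRep (Fin 2)) 𝓕 P W
      (fun t ω => c * U t ω) := by
  set r : LatticeRep (Matrix.specialUnitaryGroup (Fin 2) ℂ) := fundamentalLatticeRep 2 with hr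
  obtain ⟨σ, hσ, hcσ⟩ := exists_sign c hc
  have hflatσ : ∀ (x : Literature.MathematicalPhysics.QuantumFieldTheory.Site 3 L) (i j : Fin 3), i ≠ j →
      σ (x, i) * σ (x.shift i, j) * σ (x.shift j, i) * σ (x, j) = 1 := sign_flat c σ hσ hcσ hflat
  have hcρ : ∀ e : Edge 3 L, r.ρ (c e) = σ e • (1 : Matrix (Fin r.N) (Fin r.N) ℂ) := fun e => hcσ e
  have hQ : ∀ V : GaugeConfig 3 L (Matrix.specialUnitaryGroup (Fin 2) ℂ),
      matrixConfig r.ρ (c * V) = fun e : Edge 3 L => σ e • matrixConfig r.ρ V e :=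
    fun V => matrixConfig_centreMul r.ρ c V σ hcρ
  have hρ : ∀ (V : GaugeConfig 3 L (Matrix.specialUnitaryGroup (Fin 2) ℂ)) (e : Edge 3 L) (i j : Fin r.N),
      r.ρ ((c * V) e) i j = σ e * r.ρ (V e) i j := fun V e i j => by
    have h := congrFun (hQ V) e
    simp only [matrixConfig] at h
    rw [h, Matrix.smul_apply, smul_eq_mul]
  have hdrift : ∀ (V : GaugeConfig 3 L (Matrix.specialUnitaryGroup (Fin 2) ℂ)) (e : Edge 3 L) (i j : Fin r.N),
      (latticeLangevinDynamics r β').drift (matrixConfig r.ρ (c * V)) e i j =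
        σ e * (latticeLangevinDynamics r β').drift (matrixConfig r.ρ V) e i j := fun V e i j => by
    rw [hQ V, drift_signMul r σ hσ hflatσ β' _ e, Matrix.smul_apply, smul_eq_mul]
  have hnoise : ∀ (V : GaugeConfig 3 L (Matrix.specialUnitaryGroup (Fin 2) ℂ)) (e : Edge 3 L) (n : NoiseIdx r.N)
      (i j : Fin r.N),
      (latticeLangevinDynamics r β').noise (matrixConfig r.ρ (c * V)) e n i j =
        σ e * (latticeLangevinDynamics r β').noise (matrixConfig r.ρ V) e n i j := fun V e n i j => by
    rw [hQ V, noise_signMul r σ β' _ e n, Matrix.smul_apply, smul_eq_mul]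
  obtain ⟨J, hJ, hae⟩ := hU.exists_ito
  have hJ' : ∀ (e : Edge 3 L) (n : NoiseIdx r.N) (i j : Fin r.N),
      IsItoIntegralC (fun t ω => (latticeLangevinDynamics r β').noise (matrixConfig r.ρ (U t ω)) e n i j)
        (fun t ω => W t ω (e, n)) (J e n i j) 𝓕 P := fun e n i j => hJ e n i j
  have hae' : ∀ᵐ ω ∂P, ∀ (t : ℝ≥0) (e : Edge 3 L) (i j : Fin r.N),
      r.ρ (U t ω e) i j = r.ρ (U 0 ω e) i j +
        (∫ s in (0 : ℝ)..t, (latticeLangevinDynamics r β').drift (matrixConfig r.ρ (U s.toNNReal ω)) e i j) +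
        ∑ n : NoiseIdx r.N, J e n i j t ω := hae
  refine ⟨fun t => measurable_centreMul_comp c (hU.adapted t), ?_, ?_⟩
  · filter_upwards [hU.continuous] with ω hω using (continuous_centreMul c).comp hω
  · refine ⟨fun e n i j t ω => σ e * J e n i j t ω, fun e n i j => ?_, ?_⟩
    · have eN : (fun t ω => (latticeLangevinDynamics r β').noise (matrixConfig r.ρ (c * U t ω)) e n i j) =
          fun t ω => σ e * (latticeLangevinDynamics r β').noise (matrixConfig r.ρ (U t ω)) e n i j := by
        funext t ω
        exact hnoise (U t ω) e n i j
      have goal : IsItoIntegralC (fun t ω => (latticeLangevinDynamics r β').noise (matrixConfig r.ρ (c * U t ω)) e n i j)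
          (fun t ω => W t ω (e, n)) (fun t ω => σ e * J e n i j t ω) 𝓕 P := by
        rw [eN]
        exact isItoIntegralC_signMul (hJ' e n i j) (hσ e)
      exact goal
    · filter_upwards [hae'] with ω hω
      have key : ∀ (t : ℝ≥0) (e : Edge 3 L) (i j : Fin r.N),
          r.ρ ((c * U t ω) e) i j = r.ρ ((c * U 0 ω) e) i j +
            (∫ s in (0 : ℝ)..t, (latticeLangevinDynamics r β').drift (matrixConfig r.ρ (c * U s.toNNReal ω)) e i j) +
            ∑ n : NoiseIdx r.N, σ e * J e n i j t ω := by
        intro t e i j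
        have hint : (∫ s in (0 : ℝ)..t, (latticeLangevinDynamics r β').drift
            (matrixConfig r.ρ (c * U s.toNNReal ω)) e i j) =
            σ e * ∫ s in (0 : ℝ)..t, (latticeLangevinDynamics r β').drift (matrixConfig r.ρ (U s.toNNReal ω)) e i j := by
          rw [← intervalIntegral.integral_const_mul]
          refine intervalIntegral.integral_congr fun s _ => ?_
          exact hdrift (U s.toNNReal ω) e i j
        rw [hint, hρ (U t ω) e i j, hρ (U 0 ω) e i j, hω t e i j, mul_add, mul_add, Finset.mul_sum]
      intro t e i j
      exact key t e i j

end Transfer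

end Summit.QuantumFields.YangMills.Theorems.ColdStartUniversality.CentreCovariance

end
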